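import Summits.MatrixMultiplication.MatrixMultiplication.Theorems.SaturationLadderFrameShadows
import Summits.MatrixMultiplication.MatrixMultiplication.Theorems.SaturationLadderShadowLift
import Literature.Computability.AlgebraicComplexity.MatrixMultiplicationExponent
import HarnessLib

/-!
# The shadow square in degeneration currency: `⟨2,2,2⟩`, `2⊙⟨3,1,1⟩` (restrictions, every ring),
# `3⊙⟨2,1,1⟩`, `2⊙⟨4,1,1⟩` (degenerations)
# (route `SaturationLadder`, item stmt-MatrixMultiplication-25909 `SubexpSaturation`; cell `decomp-mm`, lens 1, gen 35)

PROVED, 0 sorry; no definitions, no instances, no notation, no named facts; route-free (imports the gen-33/34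
kernels `SaturationLadderFrameShadows` (`shadowTensor`) and `SaturationLadderShadowLift` (the collapsing lemma
`sum_restrict_shadowTensor_sq`), `Literature` and Mathlib only).

The tight shadow `N_{2,3} = shadowTensor K 2 3` is the multiplication tensor of `K[T]/(T³)` with the
multiplier leg cut to `{1, T}`; its Kronecker square `N_{2,3} ⊠ N_{2,3}` (format `9 × 4 × 9`) is the
multiplication `Q × R → R`, `R = K[x,y]/(x³,y³)` (monomial `x^i y^j` = index `(i,j)`, first factor = `x`),
`Q = span{1, x, y, xy}`.  The cell's census (instruments I98, I101, I103, bus v27) priced the Kronecker level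
`N = 2` in RESTRICTION currency: `⟨2,2,2⟩`, `3⊙⟨2,1,1⟩`, `2⊙⟨4,1,1⟩` are restrictions of the frame square
`P_{2,3}^{⊠2}`; `⟨2,2,2⟩` is also a restriction of the shadow square (I101, entries `{0, ±1}`), while
`3⊙⟨2,1,1⟩` and `2⊙⟨4,1,1⟩` are NOT (I103, rank / nilpotency arguments) — and asked (bus l.1950 (2)) whether
they are DEGENERATIONS of the shadow square.  This file answers YES for both, so that at level two the two
restriction-separating formats do not separate frame from shadow in the currency the route's items use
(`AlgDegeneratesTo`, `algBorderRank`); memo `NODE-SaturationLadder-g35.md` §2 draws the level-2 ledger.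
Here `s⊙⟨e,1,1⟩` (the census notation: `s` linearly independent multipliers, each acting as the identity on
an `e`-block) is, in the tree's convention `⟨k,m,n⟩ : (Fin k × Fin n) × (Fin k × Fin m) × (Fin m × Fin n)`,
the tensor `⟨s⟩ ⊠ ⟨1,1,e⟩ = kroneckerTensor (unitTensor K s) (matMulTensor K 1 1 e)` (format
`se × s × se`, entry `[σ = σ' = σ″]·[p = p″]`).

* §0 Bookkeeping: a restriction sum against three one-hot matrices is an evaluation, and the
  **monomially weighted sandwich** — constant matrices `V, B₀, W` twisted by `ε^{γ_i}, ε^{β_σ}, ε^{α_j}`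
  form an order-`h` degeneration as soon as the constant sandwich `Σ V B₀ W s` vanishes in weight `< h`,
  equals the target in weight `h`, and the target vanishes off weight `h` (the shape of every toric /
  Jordan-basis certificate below; BCS (15.19)).
* §1 `⟨2,2,2⟩ ≤ N_{2,3}^{⊠2}` over EVERY commutative ring (entries `{0, ±1}`): the census certificate I101
  (`census/data/engines-v27/lean/ShadowSquareMatMul222.lean`, D. census-1 g27, hand-derived module normal
  form), landed here verbatim modulo namespace as the statement of record — it supersedes the scope of the
  gen-34 `ℚ(√5)` certificate `SaturationLadderShadowLift.shadowTensor_sq_restrictsTo_matMulTensor_222`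
  (whose docstring's "rational point left open" clause is thereby settled: an integral point exists).
* §2 `2⊙⟨3,1,1⟩ = ⟨2⟩ ⊠ ⟨1,1,3⟩ ≤ N_{2,3}^{⊠2}` (every commutative ring; one-hot matrices): multipliers
  `1 ↦ 1`, `2 ↦ x`; block `1`: columns `1, y, y²` read at rows `1, y, y²`; block `2`: columns `x, xy, xy²`
  read at rows `x², x²y, x²y²` (it is the product of `⟨2⟩ ≤ N_{2,3}` — rows `1, T²`, columns `1, T` — with
  the identity `⟨1,1,3⟩ ≤ N_{1,3} ≤ N_{2,3}`).
* §3 `3⊙⟨2,1,1⟩ = ⟨3⟩ ⊠ ⟨1,1,2⟩ ⊴₂ N_{2,3}^{⊠2}` (every commutative ring): a TORIC degeneration in the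
  monomial basis — multipliers `1, x, y`; pairs (column ↦ row; weights `α_j | γ_i`):
  `1 ↦ 1 (1|1)`, `y ↦ y (0|2)` [multiplier `1`], `y² ↦ xy² (0|2)`, `x ↦ x² (0|2)` [multiplier `x`],
  `x² ↦ x²y (1|1)`, `x²y ↦ x²y² (2|0)` [multiplier `y`]; the three parasitic terms `1·x² = x²`,
  `1·x²y = x²y`, `y·1 = y` sit in weight `3 > 2`.  Found by the exhaustive toric search
  `gen35/toric_g35.py` (which also shows that `2⊙⟨4,1,1⟩` admits NO monomial assignment at all).
* §4 `2⊙⟨4,1,1⟩ = ⟨2⟩ ⊠ ⟨1,1,4⟩ ⊴₃ N_{2,3}^{⊠2}` (fields of characteristic `0`; rational certificate with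
  denominators `| 6`): multiplier plane `⟨1, n⟩`, `n = x + y`, whose multiplication operator on `R` has
  Jordan type `(5,3,1)` (`R = K[n]·1 ⊕ K[n]·(x−y) ⊕ K·(x²−xy+y²)`, `n⁴ = 6x²y²`): the `J₅`-pencil
  `s·I + t·J₅` compressed to rows `(n^{p+1})^*`, columns `n^p` (`p < 4`) is `t·I₄ + s·U` and the shift `U`
  is conjugated away (weights `α_p = p`, `γ_p = 3 − p`); the `J₃`-pencil on `K[n]·(x−y)` is flattened to
  `s·I₃` (weights `(2,1,0 | 1,2,3)`), and `K·(x²−xy+y²)` contributes `s`; five parasitic terms in weight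
  `4 > 3`.  By hand (memo §2): the determinant of an `8 × 8` compression of the pencil `L_{c₀ + c·n}` is
  divisible by `c₀(s,t)⁴` exactly (invariant factors `1⁶, c₀, c₀³, c₀⁵`), matching `det(s E₁ + t E₂) = s⁴t⁴`
  — the binary-form obstruction that forbids `I_e ⊕ I_f'` (`e + f = 9`) is silent here, and the
  construction shows the silence is genuine.
All four certificates are re-checked in exact arithmetic by `gen35/cert_g35.py`.

References: [BurgisserClausenShokrollahi1997] ((14.19), (15.19)–(15.20), (15.25)), [Blaser2013] (§4–§6),
[ChristandlVranaZuiddam2023] (§1.1 Kronecker products, unit tensors), [Strassen1988].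
-/

set_option linter.dupNamespace false

noncomputable section

open scoped BigOperators Polynomial

namespace Summit.MatrixMultiplication.MatrixMultiplication.Theorems.SaturationLadderShadowDegenerations

open Literature.Computability.AlgebraicComplexity Polynomial
open Summit.MatrixMultiplication.MatrixMultiplication.Theorems.SaturationLadderFrameShadows

universe u

variable {K : Type u} [CommRing K]

/-! ## §0 Bookkeeping: one-hot sandwiches and monomially weighted sandwiches -/

/-- A restriction sum against three one-hot matrices is an evaluation of the source tensor. [folklore] -/
theorem sum_oneHot_sandwich {ι κ μ : Type*} [Fintype ι] [Fintype κ] [Fintype μ] [DecidableEq ι]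
    [DecidableEq κ] [DecidableEq μ] (s : ι → κ → μ → K) (a₀ : ι) (b₀ : κ) (c₀ : μ) :
    (∑ a, ∑ b, ∑ c, (if a = a₀ then (1 : K) else 0) * (if b = b₀ then (1 : K) else 0) *
      (if c = c₀ then (1 : K) else 0) * s a b c) = s a₀ b₀ c₀ := by
  rw [Finset.sum_eq_single a₀ (fun a _ ha => by simp [ha]) (by simp),
    Finset.sum_eq_single b₀ (fun b _ hb => by simp [hb]) (by simp),
    Finset.sum_eq_single c₀ (fun c _ hc => by simp [hc]) (by simp)]
  simp

/-- **Monomially weighted sandwich (BCS (15.19) in coordinates).**  Constant matrices `V, B₀, W` and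
natural weights `γ, β, α` give the order-`h` degeneration `t ⊴_h s` with the polynomial matrices
`ε^{γ_i} V`, `ε^{β_σ} B₀`, `ε^{α_j} W`, provided the constant sandwich `M = Σ V B₀ W s` is `0` in total
weight `< h` and equals `t` in weight `h`, and `t` vanishes at every position of weight `≠ h`.
[cite: BurgisserClausenShokrollahi1997, (15.19)] -/
theorem isApproxRestriction_of_monomialWeights {ι κ μ ι' κ' μ' : Type*} [Fintype ι] [Fintype κ]
    [Fintype μ] {s : ι → κ → μ → K} {t : ι' → κ' → μ' → K} {h : ℕ} {V : ι' → ι → K}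
    {B₀ : κ' → κ → K} {W : μ' → μ → K} {γ : ι' → ℕ} {β : κ' → ℕ} {α : μ' → ℕ}
    (hM : ∀ a' b' c', γ a' + β b' + α c' ≤ h →
      (∑ a, ∑ b, ∑ c, V a' a * B₀ b' b * W c' c * s a b c) =
        if γ a' + β b' + α c' = h then t a' b' c' else 0)
    (ht : ∀ a' b' c', γ a' + β b' + α c' ≠ h → t a' b' c' = 0) :
    IsApproxRestriction h s t (fun a' a => C (V a' a) * X ^ γ a') (fun b' b => C (B₀ b' b) * X ^ β b')
      (fun c' c => C (W c' c) * X ^ α c') := by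
  intro a' b' c' j hj
  have hsum : (∑ a, ∑ b, ∑ c, (C (V a' a) * X ^ γ a') * (C (B₀ b' b) * X ^ β b') *
      (C (W c' c) * X ^ α c') * C (s a b c)) =
      C (∑ a, ∑ b, ∑ c, V a' a * B₀ b' b * W c' c * s a b c) * X ^ (γ a' + β b' + α c') := by
    rw [map_sum, Finset.sum_mul]
    refine Finset.sum_congr rfl fun a _ => ?_
    rw [map_sum, Finset.sum_mul]
    refine Finset.sum_congr rfl fun b _ => ?_
    rw [map_sum, Finset.sum_mul]
    refine Finset.sum_congr rfl fun c _ => ?_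
    simp only [map_mul, pow_add]
    ring
  rw [hsum, Polynomial.coeff_C_mul_X_pow]
  by_cases hje : j = γ a' + β b' + α c'
  · rw [if_pos hje, hM a' b' c' (by omega)]
    by_cases heh : γ a' + β b' + α c' = h
    · rw [if_pos heh, if_pos (by omega)]
    · rw [if_neg heh, if_neg (by omega)]
  · rw [if_neg hje]
    by_cases hjh : j = h
    · rw [if_pos hjh, ht a' b' c' (by omega)]
    · rw [if_neg hjh]

/-! ## §1 `⟨2,2,2⟩ ≤ N_{2,3}^{⊠2}` over every commutative ring (census I101) -/

set_option maxHeartbeats 2000000 in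
/-- **`⟨2,2,2⟩ ≤ N_{2,3}^{⊠2}` (restriction, every commutative ring; census instrument I101, g27).**  For
`2 × 2` matrices `X, Y` put `q_X := X₀₀ + X₀₁·x + X₁₀·y + X₁₁·xy ∈ Q` (multiplier map
`B : X_{κμ} ↦ x^μ y^κ`) and `r_Y := Y₀₀ + Y₀₁·x² + Y₁₀·(y − xy²) + Y₁₁·x ∈ R` (input map `C`); then
`(XY)₀₀ = [1](q_X r_Y) − [x²y²](q_X r_Y)`, `(XY)₀₁ = [x²](q_X r_Y)`, `(XY)₁₀ = [y](q_X r_Y) + [xy²](q_X r_Y)`,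
`(XY)₁₁ = [x²y](q_X r_Y)` (output functionals `A`; `[m]f` = coefficient of the monomial `m`).  Entries in
`{0, ±1}`: an INTEGRAL point of the restriction variety, superseding the scope of the gen-34 `ℚ(√5)` point.
Certificate and proof: the census's kernel scratch `ShadowSquareMatMul222.lean` (decomp-mm-census-1, g27),
verbatim modulo namespace. [cite: Blaser2013, §5 (the tensor ⟨k,m,n⟩)] -/
theorem shadowTensor_sq_restrictsTo_matMulTensor_222_ring :
    TensorRestrictsTo
      (kroneckerTensor (shadowTensor K 2 3) (shadowTensor K 2 3))
      (matMulTensor K 2 2 2) := by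
  classical
  let A : Fin 2 × Fin 2 → Fin 3 × Fin 3 → K := fun p a =>
    if p = (0, 0) then (if a = (0, 0) then 1 else 0) - (if a = (2, 2) then 1 else 0)
    else if p = (0, 1) then (if a = (2, 0) then 1 else 0)
    else if p = (1, 0) then (if a = (0, 1) then 1 else 0) + (if a = (1, 2) then 1 else 0)
    else (if a = (2, 1) then 1 else 0)
  let B : Fin 2 × Fin 2 → Fin 2 × Fin 2 → K := fun p b => if b = (p.2, p.1) then 1 else 0
  let C : Fin 2 × Fin 2 → Fin 3 × Fin 3 → K := fun p c =>
    if p = (0, 0) then (if c = (0, 0) then 1 else 0)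
    else if p = (0, 1) then (if c = (2, 0) then 1 else 0)
    else if p = (1, 0) then (if c = (0, 1) then 1 else 0) - (if c = (1, 2) then 1 else 0)
    else (if c = (1, 0) then 1 else 0)
  refine ⟨A, B, C, fun a' b' c' => ?_⟩
  obtain ⟨κ, ν⟩ := a'
  obtain ⟨κ', μ⟩ := b'
  obtain ⟨μ', ν'⟩ := c'
  fin_cases κ <;> fin_cases ν <;> fin_cases κ' <;> fin_cases μ <;> fin_cases μ' <;> fin_cases ν' <;>
  · simp only [A, B, C, Fin.isValue, Prod.mk.injEq, sub_mul, add_mul, ite_mul, one_mul, zero_mul]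
    simp only [Finset.sum_sub_distrib, Finset.sum_add_distrib, Finset.sum_ite_irrel,
      Finset.sum_ite_eq', Finset.mem_univ, if_true, Finset.sum_const_zero]
    simp [matMulTensor]

/-! ## §2 `2⊙⟨3,1,1⟩ = ⟨2⟩ ⊠ ⟨1,1,3⟩ ≤ N_{2,3}^{⊠2}` over every commutative ring -/

set_option maxHeartbeats 2000000 in
/-- **`⟨2⟩ ⊠ ⟨1,1,3⟩ ≤ N_{2,3} ⊠ N_{2,3}` (restriction, every commutative ring, one-hot matrices).**
Multipliers `σ = 0 ↦ 1`, `σ = 1 ↦ x`; block `0`: columns `1, y, y²` (monomials `(0,p)`) read at the rows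
`1, y, y²`; block `1`: columns `x, xy, xy²` read at the rows `x², x²y, x²y²`.  No parasitic term: `x·(0,p)`
and `1·(1,p)` are the monomials `(1,p)`, which are not rows. [cite: BurgisserClausenShokrollahi1997, (15.20)] -/
theorem shadowTensor_sq_restrictsTo_unit2_matMul113 :
    TensorRestrictsTo
      (kroneckerTensor (shadowTensor K 2 3) (shadowTensor K 2 3))
      (kroneckerTensor (unitTensor K 2) (matMulTensor K 1 1 3)) := by
  classical
  -- row / column monomials of the pair `(σ, p)` and the multiplier monomial of `σ`
  let rT : Fin 2 → Fin 3 → Fin 3 × Fin 3 :=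
    ![![((0 : Fin 3), (0 : Fin 3)), ((0 : Fin 3), (1 : Fin 3)), ((0 : Fin 3), (2 : Fin 3))],
      ![((2 : Fin 3), (0 : Fin 3)), ((2 : Fin 3), (1 : Fin 3)), ((2 : Fin 3), (2 : Fin 3))]]
  let cT : Fin 2 → Fin 3 → Fin 3 × Fin 3 :=
    ![![((0 : Fin 3), (0 : Fin 3)), ((0 : Fin 3), (1 : Fin 3)), ((0 : Fin 3), (2 : Fin 3))],
      ![((1 : Fin 3), (0 : Fin 3)), ((1 : Fin 3), (1 : Fin 3)), ((1 : Fin 3), (2 : Fin 3))]]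
  let mT : Fin 2 → Fin 2 × Fin 2 := ![((0 : Fin 2), (0 : Fin 2)), ((1 : Fin 2), (0 : Fin 2))]
  refine ⟨fun i a => if a = rT i.1 i.2.2 then 1 else 0, fun g b => if b = mT g.1 then 1 else 0,
    fun j c => if c = cT j.1 j.2.2 then 1 else 0, fun a' b' c' => ?_⟩
  beta_reduce
  rw [sum_oneHot_sandwich]
  obtain ⟨σ₁, u₁, p₁⟩ := a'
  obtain ⟨σ₂, u₂, v₂⟩ := b'
  obtain ⟨σ₃, u₃, p₃⟩ := c'
  fin_cases σ₁ <;> fin_cases u₁ <;> fin_cases p₁ <;> fin_cases σ₂ <;> fin_cases u₂ <;> fin_cases v₂ <;>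
    fin_cases σ₃ <;> fin_cases u₃ <;> fin_cases p₃ <;>
    simp [rT, cT, mT, kroneckerTensor_apply, shadowTensor_apply, unitTensor_apply, matMulTensor]

/-! ## §3 `3⊙⟨2,1,1⟩ = ⟨3⟩ ⊠ ⟨1,1,2⟩ ⊴₂ N_{2,3}^{⊠2}` over every commutative ring (toric) -/

set_option maxHeartbeats 4000000 in
/-- **`⟨3⟩ ⊠ ⟨1,1,2⟩ ⊴ N_{2,3} ⊠ N_{2,3}` (order-`2` toric degeneration, every commutative ring).**
Multipliers `σ = 0, 1, 2 ↦ 1, x, y` (weights `β = 0`); pairs `(σ,p)`: column monomial `cT σ p` with weight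
`aT σ p`, row monomial `rT σ p = (multiplier σ)·(cT σ p)` with weight `gT σ p`, `aT + gT = 2` on every pair:
`(0,0): 1 ↦ 1 (1|1)`, `(0,1): y ↦ y (0|2)`, `(1,0): y² ↦ xy² (0|2)`, `(1,1): x ↦ x² (0|2)`,
`(2,0): x² ↦ x²y (1|1)`, `(2,1): x²y ↦ x²y² (2|0)`.  The only parasitic products landing on a row are
`1·x² = x²` (weight `aT(2,0) + gT(1,1) = 3`), `1·x²y` (weight `2 + 1 = 3`) and `y·1 = y` (weight `1 + 2 = 3`),
all of order `> 2`; census I103 shows the target is NOT a restriction of the shadow square.  Found by the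
exhaustive search `gen35/toric_g35.py`, re-checked exactly by `gen35/cert_g35.py`.
[cite: BurgisserClausenShokrollahi1997, (15.19)] -/
theorem shadowTensor_sq_degeneratesTo_unit3_matMul112 :
    AlgDegeneratesTo
      (kroneckerTensor (shadowTensor K 2 3) (shadowTensor K 2 3))
      (kroneckerTensor (unitTensor K 3) (matMulTensor K 1 1 2)) := by
  classical
  let rT : Fin 3 → Fin 2 → Fin 3 × Fin 3 :=
    ![![((0 : Fin 3), (0 : Fin 3)), ((0 : Fin 3), (1 : Fin 3))],
      ![((1 : Fin 3), (2 : Fin 3)), ((2 : Fin 3), (0 : Fin 3))],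
      ![((2 : Fin 3), (1 : Fin 3)), ((2 : Fin 3), (2 : Fin 3))]]
  let cT : Fin 3 → Fin 2 → Fin 3 × Fin 3 :=
    ![![((0 : Fin 3), (0 : Fin 3)), ((0 : Fin 3), (1 : Fin 3))],
      ![((0 : Fin 3), (2 : Fin 3)), ((1 : Fin 3), (0 : Fin 3))],
      ![((2 : Fin 3), (0 : Fin 3)), ((2 : Fin 3), (1 : Fin 3))]]
  let mT : Fin 3 → Fin 2 × Fin 2 :=
    ![((0 : Fin 2), (0 : Fin 2)), ((1 : Fin 2), (0 : Fin 2)), ((0 : Fin 2), (1 : Fin 2))]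
  let gT : Fin 3 → Fin 2 → ℕ := ![![1, 2], ![2, 2], ![1, 0]]
  let aT : Fin 3 → Fin 2 → ℕ := ![![1, 0], ![0, 0], ![1, 2]]
  let V : Fin 3 × (Fin 1 × Fin 2) → Fin 3 × Fin 3 → K := fun i a => if a = rT i.1 i.2.2 then 1 else 0
  let B₀ : Fin 3 × (Fin 1 × Fin 1) → Fin 2 × Fin 2 → K := fun g b => if b = mT g.1 then 1 else 0
  let W : Fin 3 × (Fin 1 × Fin 2) → Fin 3 × Fin 3 → K := fun j c => if c = cT j.1 j.2.2 then 1 else 0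
  let γ : Fin 3 × (Fin 1 × Fin 2) → ℕ := fun i => gT i.1 i.2.2
  let β : Fin 3 × (Fin 1 × Fin 1) → ℕ := fun _ => 0
  let α : Fin 3 × (Fin 1 × Fin 2) → ℕ := fun j => aT j.1 j.2.2
  have hM : ∀ a' b' c', γ a' + β b' + α c' ≤ 2 →
      (∑ a, ∑ b, ∑ c, V a' a * B₀ b' b * W c' c *
        kroneckerTensor (shadowTensor K 2 3) (shadowTensor K 2 3) a b c) =
      if γ a' + β b' + α c' = 2 then
        kroneckerTensor (unitTensor K 3) (matMulTensor K 1 1 2) a' b' c' else 0 := by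
    intro a' b' c'
    simp only [V, B₀, W]
    rw [sum_oneHot_sandwich]
    obtain ⟨σ₁, u₁, p₁⟩ := a'
    obtain ⟨σ₂, u₂, v₂⟩ := b'
    obtain ⟨σ₃, u₃, p₃⟩ := c'
    fin_cases σ₁ <;> fin_cases u₁ <;> fin_cases p₁ <;> fin_cases σ₂ <;> fin_cases u₂ <;> fin_cases v₂ <;>
      fin_cases σ₃ <;> fin_cases u₃ <;> fin_cases p₃ <;>
      simp [γ, β, α, rT, cT, mT, gT, aT, kroneckerTensor_apply, shadowTensor_apply, unitTensor_apply,
        matMulTensor]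
  have ht : ∀ a' b' c', γ a' + β b' + α c' ≠ 2 →
      kroneckerTensor (unitTensor K 3) (matMulTensor K 1 1 2) a' b' c' = 0 := by
    intro a' b' c'
    obtain ⟨σ₁, u₁, p₁⟩ := a'
    obtain ⟨σ₂, u₂, v₂⟩ := b'
    obtain ⟨σ₃, u₃, p₃⟩ := c'
    fin_cases σ₁ <;> fin_cases u₁ <;> fin_cases p₁ <;> fin_cases σ₂ <;> fin_cases u₂ <;> fin_cases v₂ <;>
      fin_cases σ₃ <;> fin_cases u₃ <;> fin_cases p₃ <;>
      simp [γ, β, α, gT, aT, kroneckerTensor_apply, unitTensor_apply, matMulTensor]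
  exact ⟨2, _, _, _, isApproxRestriction_of_monomialWeights hM ht⟩

end Summit.MatrixMultiplication.MatrixMultiplication.Theorems.SaturationLadderShadowDegenerations

/-! ## §4 `2⊙⟨4,1,1⟩ = ⟨2⟩ ⊠ ⟨1,1,4⟩ ⊴₃ N_{2,3}^{⊠2}` in characteristic `0` (Jordan type `(5,3,1)`) -/

namespace Summit.MatrixMultiplication.MatrixMultiplication.Theorems.SaturationLadderShadowDegenerations

open Literature.Computability.AlgebraicComplexity Polynomial
open Summit.MatrixMultiplication.MatrixMultiplication.Theorems.SaturationLadderFrameShadows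

universe v

variable {K : Type v} [Field K]

set_option maxHeartbeats 8000000 in
/-- **`⟨2⟩ ⊠ ⟨1,1,4⟩ ⊴ N_{2,3} ⊠ N_{2,3}` (order-`3` degeneration; fields of characteristic `0`).**
Jordan basis of `L_n`, `n = x + y`, on `R = K[x,y]/(x³,y³)`: `b₁..b₅ = 1, n, n², n³, n⁴` (`n² = x²+2xy+y²`,
`n³ = 3x²y+3xy²`, `n⁴ = 6x²y²`), `b₆..b₈ = x−y, x²−y², x²y−xy²`, `b₉ = x²−xy+y²`; `vT` lists the dual
functionals used as rows (denominators `| 6`), `wT` the basis vectors used as columns.  Multipliers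
`σ = 0 ↦ 1`, `σ = 1 ↦ n` (`bT`).  Block `0` (multiplier `1`): pairs `(b₆,b₆^*), (b₇,b₇^*), (b₈,b₈^*), (b₉,b₉^*)`
with weights `(α | γ) = (2|1), (1|2), (0|3), (0|3)`; block `1` (multiplier `n`): pairs `(n^p, (n^{p+1})^*)`,
`p < 4`, weights `(p | 3−p)`.  Parasitic terms: `1·n^{p+1}` read by `(n^{p+1})^*` from column `n^{p+1}`
(weight `(p+1) + (3−p) = 4`) and `n·b₆ = b₇`, `n·b₇ = b₈` (weights `2+2`, `1+3`), all of order `4 > 3`.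
Census I103: the target is NOT a restriction of the shadow square; `toric_g35.py`: it has no monomial
certificate either.  Re-checked exactly by `gen35/cert_g35.py`. [cite: BurgisserClausenShokrollahi1997, (15.19)] -/
theorem shadowTensor_sq_degeneratesTo_unit2_matMul114 [CharZero K] :
    AlgDegeneratesTo
      (kroneckerTensor (shadowTensor K 2 3) (shadowTensor K 2 3))
      (kroneckerTensor (unitTensor K 2) (matMulTensor K 1 1 4)) := by
  classical
  let vT : Fin 2 → Fin 4 → Fin 3 → Fin 3 → K := ![![![![(0 : K), ((-1 : K) / 2), (0 : K)], ![((1 : K) / 2), (0 : K), (0 : K)], ![(0 : K), (0 : K), (0 : K)]], ![![(0 : K), (0 : K), ((-1 : K) / 2)], ![(0 : K), (0 : K), (0 : K)], ![((1 : K) / 2), (0 : K), (0 : K)]], ![![(0 : K), (0 : K), (0 : K)], ![(0 : K), (0 : K), ((-1 : K) / 2)], ![(0 : K), ((1 : K) / 2), (0 : K)]], ![![(0 : K), (0 : K), ((1 : K) / 3)], ![(0 : K), ((-1 : K) / 3), (0 : K)], ![((1 : K) / 3), (0 : K), (0 : K)]]], ![![![(0 : K), ((1 : K) / 2), (0 :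 K)], ![((1 : K) / 2), (0 : K), (0 : K)], ![(0 : K), (0 : K), (0 : K)]], ![![(0 : K), (0 : K), ((1 : K) / 6)], ![(0 : K), ((1 : K) / 3), (0 : K)], ![((1 : K) / 6), (0 : K), (0 : K)]], ![![(0 : K), (0 : K), (0 : K)], ![(0 : K), (0 : K), ((1 : K) / 6)], ![(0 : K), ((1 : K) / 6), (0 : K)]], ![![(0 : K), (0 : K), (0 : K)], ![(0 : K), (0 : K), (0 : K)], ![(0 : K), (0 : K), ((1 : K) / 6)]]]]
  let wT : Fin 2 → Fin 4 → Fin 3 → Fin 3 → K := ![![![![(0 : K), (-1 : K), (0 : K)], ![(1 : K), (0 : K), (0 : K)], ![(0 : K), (0 : K), (0 : K)]], ![![(0 : K), (0 : K), (-1 : K)], ![(0 : K), (0 : K), (0 : K)], ![(1 : K), (0 : K), (0 : K)]], ![![(0 : K), (0 : K), (0 : K)], ![(0 : K), (0 : K), (-1 : K)], ![(0 : K), (1 : K), (0 : K)]], ![![(0 : K), (0 : K), (1 : K)], ![(0 : K), (-1 : K), (0 : K)], ![(1 : K), (0 : K), (0 : K)]]], ![![![(1 : K), (0 : K), (0 :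 K)], ![(0 : K), (0 : K), (0 : K)], ![(0 : K), (0 : K), (0 : K)]], ![![(0 : K), (1 : K), (0 : K)], ![(1 : K), (0 : K), (0 : K)], ![(0 : K), (0 : K), (0 : K)]], ![![(0 : K), (0 : K), (1 : K)], ![(0 : K), (2 : K), (0 : K)], ![(1 : K), (0 : K), (0 : K)]], ![![(0 : K), (0 : K), (0 : K)], ![(0 : K), (0 : K), (3 : K)], ![(0 : K), (3 : K), (0 : K)]]]]
  let bT : Fin 2 → Fin 2 → Fin 2 → K := ![![![1, 0], ![0, 0]], ![![0, 1], ![1, 0]]]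
  let gT : Fin 2 → Fin 4 → ℕ := ![![1, 2, 3, 3], ![3, 2, 1, 0]]
  let aT : Fin 2 → Fin 4 → ℕ := ![![2, 1, 0, 0], ![0, 1, 2, 3]]
  let V : Fin 2 × (Fin 1 × Fin 4) → Fin 3 × Fin 3 → K := fun i a => vT i.1 i.2.2 a.1 a.2
  let B₀ : Fin 2 × (Fin 1 × Fin 1) → Fin 2 × Fin 2 → K := fun g b => bT g.1 b.1 b.2
  let W : Fin 2 × (Fin 1 × Fin 4) → Fin 3 × Fin 3 → K := fun j c => wT j.1 j.2.2 c.1 c.2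
  let γ : Fin 2 × (Fin 1 × Fin 4) → ℕ := fun i => gT i.1 i.2.2
  let β : Fin 2 × (Fin 1 × Fin 1) → ℕ := fun _ => 0
  let α : Fin 2 × (Fin 1 × Fin 4) → ℕ := fun j => aT j.1 j.2.2
  have hM : ∀ a' b' c', γ a' + β b' + α c' ≤ 3 →
      (∑ a, ∑ b, ∑ c, V a' a * B₀ b' b * W c' c *
        kroneckerTensor (shadowTensor K 2 3) (shadowTensor K 2 3) a b c) =
      if γ a' + β b' + α c' = 3 then
        kroneckerTensor (unitTensor K 2) (matMulTensor K 1 1 4) a' b' c' else 0 := by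
    intro a' b' c'
    rw [SaturationLadderShadowLift.sum_restrict_shadowTensor_sq V B₀ W a' b' c']
    obtain ⟨σ₁, u₁, p₁⟩ := a'
    obtain ⟨σ₂, u₂, v₂⟩ := b'
    obtain ⟨σ₃, u₃, p₃⟩ := c'
    simp only [V, B₀, W, γ, β, α]
    fin_cases σ₁ <;> fin_cases u₁ <;> fin_cases p₁ <;> fin_cases σ₂ <;> fin_cases u₂ <;> fin_cases v₂ <;>
      fin_cases σ₃ <;> fin_cases u₃ <;> fin_cases p₃ <;>
      simp [vT, wT, bT, gT, aT, kroneckerTensor_apply, unitTensor_apply, matMulTensor] <;> norm_num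
  have ht : ∀ a' b' c', γ a' + β b' + α c' ≠ 3 →
      kroneckerTensor (unitTensor K 2) (matMulTensor K 1 1 4) a' b' c' = 0 := by
    intro a' b' c'
    obtain ⟨σ₁, u₁, p₁⟩ := a'
    obtain ⟨σ₂, u₂, v₂⟩ := b'
    obtain ⟨σ₃, u₃, p₃⟩ := c'
    fin_cases σ₁ <;> fin_cases u₁ <;> fin_cases p₁ <;> fin_cases σ₂ <;> fin_cases u₂ <;> fin_cases v₂ <;>
      fin_cases σ₃ <;> fin_cases u₃ <;> fin_cases p₃ <;>
      simp [γ, β, α, gT, aT, kroneckerTensor_apply, unitTensor_apply, matMulTensor]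
  exact ⟨3, _, _, _, isApproxRestriction_of_monomialWeights hM ht⟩

/-- The summit's field: `⟨2⟩ ⊠ ⟨1,1,4⟩ ⊴ N_{2,3} ⊠ N_{2,3}` over `ℂ`. [cite: BurgisserClausenShokrollahi1997, (15.19)] -/
theorem shadowTensor_sq_degeneratesTo_unit2_matMul114_complex :
    AlgDegeneratesTo
      (kroneckerTensor (shadowTensor ℂ 2 3) (shadowTensor ℂ 2 3))
      (kroneckerTensor (unitTensor ℂ 2) (matMulTensor ℂ 1 1 4)) :=
  shadowTensor_sq_degeneratesTo_unit2_matMul114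

end Summit.MatrixMultiplication.MatrixMultiplication.Theorems.SaturationLadderShadowDegenerations
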